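import Summits.RiemannHypothesis.RiemannHypothesis.Theorems.TiltedLandingLaw421.Negative.AlphaSealDatum

/-!
# `TiltedLandingLaw421` (crux stmt-RiemannHypothesis-24774, route `EarlyAppointments`) — negative-side support:
# the W-08 round-2 α-stub statement `RhW08.Round2.AlphaSealTrkD'` is FALSE as typed

`sorry`-free, standard axioms, ONE explicit polynomial witness. Filed `--supports stmt-RiemannHypothesis-24774`
(negative lane `Theorems/TiltedLandingLaw421/Negative/`) by the W-07/W-08 critic of record (rh-split-ref-2 g20),
cert `RESULT-7-alpha-kill-g20.md` sha16 f6150880174abb77. stub-false: `stub_alphaSealTrkD'` of the registered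
skeleton `Cruxes/TiltedLandingLaw421/Lines/trkD_v2R.lean` (sha256 d97327ed…) has statement `RhW08.Round2.AlphaSealTrkD'`
(`Theorems/TiltedLandingLaw421R2NodeD.lean`), i.e. `IsolatedPairDropLowG (1/4) PSealC4 StTrkD ReadyR2`: «under
`EngineHyps5 2`, a lowest tracked column state that is sealed by `PSealC4` at a level that is not `ReadyR2` has a
tracked successor at the next level at least `s/4` lower».

**Witness (datum D\*).** `f z = z⁵ + z³ = z³(z²+1)` (real entire polynomial; zeros `0` triple, `±i` simple),
`(η, x₀, s, hmax, R, Hs, B) = (1/2, 0, 23/25, 2, 40, 1, 64)`, level `j = 0`, state `u = i`: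
* `EngineHyps5 2 …` holds (`engineHyps5_D`, part 1 = `Negative/AlphaSealDatum.lean`, where the witness `fW` lives): growth `‖f z‖ ≤ 2·e^{5‖z‖}` (order `1 < 2`); `2s ≤ hmax`, `2hmax ≤ R`,
  `3hmax < R`, zeros in `|Im| ≤ Hs = 1`, `2Hs ≤ R`, `w₀ = i`; column budget (total zero mass `5 ≤ B`), half-slab
  budgets (half-slabs carry no zeros; `r/s ≤ 1000/23 ≤ 65`), `η ∈ [0, 1/2]`; `RemainderBox`: for `|Re w| < 20` the
  near set is the whole zero set and the remainder is identically `0`, on the edge `|Re w| = 20` the near set is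
  empty and `‖f′/f‖ ≤ 25/46 = η/s`.
* `i` is the only level-0 state, hence lowest and tracked (`isLowest_D`); level 0 is not `ReadyR2` (`not_readyR2_D`):
  no NL event (`Re f′(x) = 5x⁴+3x² = 0 ⇒ x = 0`, where `f(0) = 0`) and no sign window (`LocalA` fails at the non-real
  critical point `i√(3/5)` inside every admissible box); the seal holds (`pSealC4_D`): `cExt = −3i`, `dMin = 1`,
  `ι = 3 ≥ 2`, `pairNewtonRoot = i(√10−1)/3` so `dX = 0`, child height `(√10−1)/3 ≥ s/20`, and
  `dP = (4−√10)/3 = 0.27924… ≥ (7/25)s + (7/50)s/ι² = 0.27191…`.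
* every level-1 state `u'` (zero of `f′ = z²(5z²+3)` in the upper half plane) has `Im u' = √(3/5) = 0.7746… >
  1 − s/4 = 0.77`, so `SuccOf (1/4) StTrkD … 0 i` fails (`alphaSealTrkD'_false`).

Corollaries through the tree bridges of `TiltedLandingLaw421R2CoreP` (#999): `¬ RhW08.Round2.NearestDropSeal'`
(`nearestDropSeal'_false`) and `¬ RhW08.Round2.HeightLemmaCore'` (`heightLemmaCore'_false`) — the E08″ by-name target
`heightLemma_core'` is unprovable. The CRUX `TiltedLandingLaw421` is NOT refuted by D\* (it lands by an NL event at
level 3, inside its budget); the other registered stub `stub_zRestTrkDHFR'` is not touched. Mechanism (for the round-3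
seal): zero mass of `f^{(j)}` on the axis UNDER the pair (`ι = dMin·‖cExt‖` books an `m`-fold zero at distance `dMin`
as isolation `ι = m`) makes the frozen pair-Newton predictor `dP` over-state the true one-step drop; `s` is a free
scale, so the adversary dials `s` up to the seal. Nothing here bears on the truth of RH; a polynomial is not `ξ`.
-/

set_option linter.dupNamespace false  -- the mandated namespace repeats `RiemannHypothesis`

namespace Summit.RiemannHypothesis.RiemannHypothesis.Theorems.TiltedLandingLaw421.Negative

open Complex Set Filter
open RhIdea6.G17.W07C7 RhIdea6.G17.W07C7.Rev6

/-! ## The seal quantities at the state `u = i` (level 0) of the datum. -/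

open RhIdea6.G18.W07C8.Law421BirthS RhIdea6.G19.W07C11.Seam RhIdea6.G20.W07C12.Frac
open RhIdea6.G20.W07C12.StColP RhW07.C12.FieldSplit
open Summit.RiemannHypothesis.RiemannHypothesis.Theorems.Splittings.JensenWindow (LocalA)

/-- the distances from `i` to the other zeros of `fW⁽⁰⁾` (excluding `i`, `conj i`): `{1}`. -/
theorem dMin_set_eq :
    {d : ℝ | ∃ r : ℂ, iteratedDeriv 0 fW r = 0 ∧ r ≠ I ∧ r ≠ (starRingEnd ℂ) I ∧ d = ‖I - r‖} = {1} := by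
  ext d
  simp only [Set.mem_setOf_eq, Set.mem_singleton_iff, iteratedDeriv_zero_fW, fW_eq_zero_iff, conj_I]
  constructor
  · rintro ⟨r, hr, h1, h2, rfl⟩
    rcases hr with rfl | rfl | rfl
    · simp
    · exact absurd rfl h1
    · exact absurd rfl h2
  · rintro rfl
    exact ⟨0, Or.inl rfl, fun h => I_ne_zero h.symm, fun h => I_ne_zero (neg_eq_zero.1 h.symm), by simp⟩

/-- `dMin fW 0 i = 1`. -/
theorem dMin_D : dMin fW 0 I = 1 := by
  unfold dMin; rw [dMin_set_eq, csInf_singleton]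

/-- `cExt fW 0 i = f″(i)/(2f′(i)) + i/(2·Im i) = −7i/2 + i/2 = −3i`. -/
theorem cExt_D : cExt fW 0 I = -3 * I := by
  simp only [cExt, zero_add, iteratedDeriv_two_fW, iteratedDeriv_one_fW, fW1, fW2, I_im, ofReal_one]
  have I_pow_three : I ^ 3 = -I := by rw [pow_succ, I_sq]; ring
  have I_pow_four : I ^ 4 = 1 := by rw [show (4 : ℕ) = 2 + 2 from rfl, pow_add, I_sq]; ring
  rw [I_pow_three, I_pow_four, I_sq]
  ring

/-- `(−3i)⁻¹ = i/3`. -/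
theorem inv_neg3I : (-3 * I : ℂ)⁻¹ = I / 3 := by
  apply inv_eq_of_mul_eq_one_right
  linear_combination (-1 : ℂ) * I_mul_I

/-- `10^{1/2} = √10` (principal branch, as used by `pairNewtonRoots`). -/
theorem ten_cpow_half : (10 : ℂ) ^ ((1 : ℂ) / 2) = ((Real.sqrt 10 : ℝ) : ℂ) := by
  rw [Real.sqrt_eq_rpow, Complex.ofReal_cpow (by norm_num) (1 / 2)]
  push_cast
  rfl

/-- the two pair-Newton roots for `c = −3i`, `ε = 1`: `i(√10 − 1)/3` and `−i(√10 + 1)/3`. -/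
theorem pairNewtonRoots_D : pairNewtonRoots (-3 * I) 1 =
    ((((Real.sqrt 10 - 1) / 3 : ℝ) : ℂ) * I, (((-(Real.sqrt 10 + 1)) / 3 : ℝ) : ℂ) * I) := by
  have h10 : (1 - (-3 * I) ^ 2 * ((1 : ℝ) : ℂ) ^ 2) = (10 : ℂ) := by
    push_cast; linear_combination (-9 : ℂ) * I_mul_I
  have hd : (1 - (-3 * I) ^ 2 * ((1 : ℝ) : ℂ) ^ 2) ^ ((1 : ℂ) / 2) = ((Real.sqrt 10 : ℝ) : ℂ) := by
    rw [h10, ten_cpow_half]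
  unfold pairNewtonRoots
  simp only [hd]
  refine Prod.ext ?_ ?_
  · show (-1 + ((Real.sqrt 10 : ℝ) : ℂ)) / (-3 * I) = (((Real.sqrt 10 - 1) / 3 : ℝ) : ℂ) * I
    rw [div_eq_mul_inv, inv_neg3I]; push_cast; ring
  · show (-1 - ((Real.sqrt 10 : ℝ) : ℂ)) / (-3 * I) = (((-(Real.sqrt 10 + 1)) / 3 : ℝ) : ℂ) * I
    rw [div_eq_mul_inv, inv_neg3I]; push_cast; ring

/-- `√10 < 3.17`. -/
theorem sqrt10_lt : Real.sqrt 10 < 3.17 := by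
  rw [Real.sqrt_lt' (by norm_num)]; norm_num

/-- `3 < √10`. -/
theorem lt_sqrt10 : 3 < Real.sqrt 10 := by
  rw [Real.lt_sqrt (by norm_num)]; norm_num

/-- the selected (nearer to `iε = i`) pair-Newton root is `i(√10 − 1)/3`. -/
theorem pairNewtonRoot_D : pairNewtonRoot (-3 * I) 1 = (((Real.sqrt 10 - 1) / 3 : ℝ) : ℂ) * I := by
  have h10 := sqrt10_lt
  have h10' := lt_sqrt10
  unfold pairNewtonRoot
  rw [pairNewtonRoots_D]
  split_ifs with hc
  · rfl
  · exfalso; apply hc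
    show ‖(((Real.sqrt 10 - 1) / 3 : ℝ) : ℂ) * I - ((1 : ℝ) : ℂ) * I‖ ≤
      ‖(((-(Real.sqrt 10 + 1)) / 3 : ℝ) : ℂ) * I - ((1 : ℝ) : ℂ) * I‖
    have e1 : (((Real.sqrt 10 - 1) / 3 : ℝ) : ℂ) * I - ((1 : ℝ) : ℂ) * I =
        (((Real.sqrt 10 - 1) / 3 - 1 : ℝ) : ℂ) * I := by push_cast; ring
    have e2 : (((-(Real.sqrt 10 + 1)) / 3 : ℝ) : ℂ) * I - ((1 : ℝ) : ℂ) * I =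
        (((-(Real.sqrt 10 + 1)) / 3 - 1 : ℝ) : ℂ) * I := by push_cast; ring
    rw [e1, e2, norm_mul, norm_mul, norm_I, mul_one, mul_one, Complex.norm_real, Complex.norm_real,
      Real.norm_eq_abs, Real.norm_eq_abs, abs_of_nonpos (by linarith), abs_of_nonpos (by linarith)]
    linarith

/-- predicted child height `(√10 − 1)/3`. -/
theorem childIm_D : (pairNewtonRoot (cExt fW 0 I) (I : ℂ).im).im = (Real.sqrt 10 - 1) / 3 := by
  rw [cExt_D, I_im, pairNewtonRoot_D]; simp

/-- predicted drop `dP fW 0 i = (4 − √10)/3 = 0.27924…`. -/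
theorem dP_D : dP fW 0 I = (4 - Real.sqrt 10) / 3 := by
  unfold dP; rw [childIm_D, I_im]; ring

/-- predicted horizontal displacement `dX fW 0 i = 0`. -/
theorem dX_D : dX fW 0 I = 0 := by
  unfold dX; rw [cExt_D, I_im, pairNewtonRoot_D]; simp

/-- isolation `ι = dMin · ‖cExt‖ = 3`. -/
theorem iota_D : iota fW 0 I = 3 := by
  unfold iota; rw [dMin_D, cExt_D]; simp

/-- ★ the state `u = i` is SEALED by `PSealC4` for the scale `s = 23/25`. -/
theorem pSealC4_D : PSealC4 (1 / 2) fW 0 (23 / 25) 2 40 1 64 0 I := by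
  have h10 := sqrt10_lt
  have h10' := lt_sqrt10
  show 2 ≤ iota fW 0 I ∧ (1 / 20 : ℝ) * (23 / 25) ≤ (pairNewtonRoot (cExt fW 0 I) (I : ℂ).im).im ∧
    |dX fW 0 I| ≤ (1 / 5 : ℝ) * (23 / 25) ∧
    (7 / 25 : ℝ) * (23 / 25) + (7 / 50 : ℝ) * (23 / 25) / iota fW 0 I ^ 2 ≤ dP fW 0 I
  rw [iota_D, childIm_D, dX_D, dP_D]
  refine ⟨by norm_num, by linarith, by norm_num, by linarith⟩

/-! ## The dynamics: states, tracked states, readiness at level 0. -/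

open RhW08.Round1 RhW08.StSwap RhIdea6.G17.W07C7

/-- `i` is a level-0 column state (`StCol'`). -/
theorem stCol0_D : StCol' (1 / 2) fW 0 (23 / 25) 2 40 1 64 0 I := by
  show iteratedDeriv 0 fW ≠ 0 ∧ iteratedDeriv 0 fW I = 0 ∧ 0 < I.im ∧
    |I.re - 0| ≤ 40 / 2 + ((0 : ℕ) : ℝ) * ((23 / 25) / 4) ∧ I.im ≤ 1
  rw [iteratedDeriv_zero_fW]
  exact ⟨fW_ne_zero, fW_I, by simp, by norm_num, by simp⟩

/-- `i` is the ONLY level-0 column state. -/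
theorem stCol0_eq {w : ℂ} (hw : StCol' (1 / 2) fW 0 (23 / 25) 2 40 1 64 0 w) : w = I := by
  obtain ⟨-, hz, him, -, -⟩ := hw
  rw [iteratedDeriv_zero_fW, fW_eq_zero_iff] at hz
  rcases hz with rfl | rfl | rfl
  · norm_num at him
  · rfl
  · norm_num at him

/-- every level-1 column state `w` has `0 < Im w` and `(Im w)² = 3/5`. -/
theorem stCol1_im {w : ℂ} (hw : StCol' (1 / 2) fW 0 (23 / 25) 2 40 1 64 1 w) :
    0 < w.im ∧ w.im ^ 2 = 3 / 5 := by
  obtain ⟨-, hz, him, -, -⟩ := hw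
  rw [iteratedDeriv_one_fW] at hz
  exact ⟨him, (fW1_zero_im w hz him).2⟩

/-- `i` is tracked at level 0 (`StTrkD`, chain `c ≡ i`). -/
theorem stTrkD0_D : StTrkD (1 / 2) fW 0 (23 / 25) 2 40 1 64 0 I :=
  ⟨fun _ => I, stCol0_D, by simp, rfl, fun m hm => absurd hm (Nat.not_lt_zero m)⟩

/-- `i` is the lowest tracked level-0 state. -/
theorem isLowest_D : IsLowest StTrkD (1 / 2) fW 0 (23 / 25) 2 40 1 64 0 I := by
  refine ⟨stTrkD0_D, fun w hw => ?_⟩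
  obtain ⟨c, hc0, -, hcj, -⟩ := hw
  rw [hcj] at hc0
  rw [stCol0_eq hc0]

/-- no NL event at level 0: `Re fW′(x) = 5x⁴ + 3x² = 0` forces `x = 0`, where `fW(0) = 0`. -/
theorem not_tiltReady_D : ¬ TiltReady (1 / 2) fW 0 (23 / 25) 2 40 1 64 0 I := by
  rintro ⟨x, -, h1, h0, -⟩
  rw [zero_add, iteratedDeriv_one_fW] at h1
  rw [iteratedDeriv_zero_fW] at h0
  have e : fW1 (x : ℂ) = ((5 * x ^ 4 + 3 * x ^ 2 : ℝ) : ℂ) := by unfold fW1; push_cast; ring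
  rw [e, ofReal_re] at h1
  have hx2 : x ^ 2 = 0 := by nlinarith [sq_nonneg x, sq_nonneg (x ^ 2)]
  have hx : x = 0 := pow_eq_zero_iff (by norm_num) |>.1 hx2
  rw [hx, ofReal_zero, fW_zero] at h0
  simp at h0

/-- no sign window at level 0: any window box contains `±i`, hence the non-real critical point `ρW`, so `LocalA` fails. -/
theorem not_windowReady_D : ¬ WindowReady (1 / 2) fW 0 (23 / 25) 2 40 1 64 0 I := by
  rintro ⟨α, β, H, -, -, hS⟩
  rw [iteratedDeriv_zero_fW] at hS
  obtain ⟨-, hH, -, -, -, -, -, -, -, hA, ρ, hρ, hρ0, hρim⟩ := hS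
  rw [Complex.mem_reProdIm] at hρ
  obtain ⟨⟨hαρ, hρβ⟩, hHρ, hρH⟩ := hρ
  rw [fW_eq_zero_iff] at hρ0
  have hre : ρ.re = 0 := by rcases hρ0 with rfl | rfl | rfl <;> simp
  have hH1 : 1 < H := by
    rcases hρ0 with rfl | rfl | rfl
    · simp at hρim
    · simpa using hρH
    · simp at hHρ; linarith
  rw [hre] at hαρ hρβ
  have hmem : ρW ∈ Set.Ioo α β ×ℂ Set.Ioo (-H) H := by
    rw [Complex.mem_reProdIm, ρW_re]
    refine ⟨⟨hαρ, hρβ⟩, ?_, ?_⟩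
    · linarith [ρW_im_pos]
    · linarith [ρW_im_lt_one]
  have h0 := hA ρW hmem (by rw [deriv_fW]; exact fW1_ρW)
  exact absurd h0 (ne_of_gt ρW_im_pos)

/-- level 0 is not `ReadyR2` at `i`. -/
theorem not_readyR2_D : ¬ ReadyR2 (1 / 2) fW 0 (23 / 25) 2 40 1 64 0 I := by
  rintro ⟨j', hj', hR⟩
  obtain rfl : j' = 0 := Nat.le_zero.1 hj'
  rcases hR with hW | hT
  · exact not_windowReady_D hW
  · exact not_tiltReady_D hT

/-- ★★★ **The registered round-2 α-stub statement is false.**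
`AlphaSealTrkD′ = IsolatedPairDropLowG (1/4) PSealC4 StTrkD ReadyR2` fails at the legal datum
`(η, f, x₀, s, hmax, R, Hs, B) = (1/2, z⁵+z³, 0, 23/25, 2, 40, 1, 64)`, level `0`, state `i`:
the state is lowest, tracked, sealed (`ι = 3`, `dP = (4-√10)/3 ≥ 0.28 s + 0.14 s/ι²`), the level is not
Ready′ (no NL event: the only real critical point of `f` is its zero `0`; no sign window: `LocalA` fails at
`i√(3/5)`), yet every tracked level-1 state has imaginary part `√(3/5) > 1 - s/4 = 0.77`. -/
theorem alphaSealTrkD'_false : ¬ RhW08.Round2.AlphaSealTrkD' := by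
  intro h
  have hstep := h (1 / 2) fW 0 (23 / 25) 2 40 1 64 engineHyps5_D 0 I isLowest_D not_readyR2_D pSealC4_D
  obtain ⟨u', hu', hdrop⟩ := hstep
  obtain ⟨c, -, -, hc1, hsteps⟩ := hu'
  have hcol := (hsteps 0 (by norm_num)).1
  rw [hc1] at hcol
  obtain ⟨hpos, hsq⟩ := stCol1_im hcol
  rw [I_im, abs_of_pos hpos, abs_one] at hdrop
  nlinarith [hsq, hpos, hdrop]


/-- Corollary via the tree bridge `alphaSealTrkD'_of_nearestDrop'` (E08″, #999): the nearest-drop form of the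
round-2 seal law is false as typed. -/
theorem nearestDropSeal'_false : ¬ RhW08.Round2.NearestDropSeal' :=
  fun h => alphaSealTrkD'_false (RhW08.Round2.alphaSealTrkD'_of_nearestDrop' h)

/-- Corollary via the tree bridge `alphaSealTrkD'_of_core'` (E08″, #999): the round-2 HEIGHT LEMMA CORE′ — the
E08″ by-name proof obligation `heightLemma_core' : RhW08.Round2.HeightLemmaCore'` — is false as typed. -/
theorem heightLemmaCore'_false : ¬ RhW08.Round2.HeightLemmaCore' :=
  fun h => alphaSealTrkD'_false (RhW08.Round2.alphaSealTrkD'_of_core' h)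

end Summit.RiemannHypothesis.RiemannHypothesis.Theorems.TiltedLandingLaw421.Negative
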